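import Literature.NumberTheory.Irrationality.LaiYu2020.AuxiliaryFunction
import Literature.NumberTheory.Irrationality.FischlerSprangZudilin2019.Lemma3LogSums
import HarnessLib

/-!
# Lai–Yu 2020, Lemma 4.1 (analysis lemma) — part 1: the shifted terms `R̂_n(k+θ)` and their uniform
# logarithmic size

Topic `Literature/NumberTheory/Irrationality/LaiYu2020`, namespace
`Literature.NumberTheory.Irrationality.LaiYu2020` (helpers in the sub-namespace `Lemma41`). Source: L. Lai, P. Yu,
*A note on the number of irrational odd zeta values*, Compositio Math. **156** (2020) 1699–1717 = arXiv:1911.08458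
[LaiYu2020], §4 "Analysis lemmas", proof of Lemma 4.1 (held: `paper:arxiv-1911.08458`, arXiv text pp. 8–9, read on
the page). First of the files PROVING Lemma 4.1 for the auxiliary function `R_n` of `AuxiliaryFunction.lean`
(`r = u/v`, `n = vm`); everything here is proved, no named facts.

## The source, verbatim (the step formalised here)
"For any `θ ∈ 𝓕_B`, since `R_n(m+θ) = 0` for `m = 1,2,⋯,rn−1`, we define the shift version of the auxiliary rational
functions: `R̂_n(t) = R_n(t+rn)`, then … `r_{n,θ} = ∑_{k=0}^{∞} R̂_n(k+θ)`. We have the following two expressions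
for `R̂_n(t)`: `R̂_n(t) = A₁(B)ⁿ A₂(B)ⁿ n!^{s+1}/(n/den(r))!^{den(r)(2r+1)|𝓕_B|} ·
t ∏_{θ'∈𝓕_B} ∏_{j=0}^{(2r+1)n−1} (t+j+θ') / ∏_{j=0}^{n} (t+rn+j)^{s+1} = …` [(4.2)–(4.3)] … "By applying Stirling's
formula in the weak form `Γ(x) = x^{O(1)} (x/e)^x` … a calculation shows that as `n → +∞`:
`R̂_n(k+θ) = n^{O(1)} · A₁(B)ⁿA₂(B)ⁿ den(r)^{(2r+1)|𝓕_B|n} ((κ+2r+1)^{κ+2r+1}/κ^κ)^{|𝓕_B|n}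
((κ+r)^{κ+r}/(κ+r+1)^{κ+r+1})^{(s+1)n} = n^{O(1)} (f(κ)^κ g(κ))ⁿ = n^{O(1)} h(κ)ⁿ` uniformly for any
`k ∈ [c₁n, n^{10}]` and any `θ ∈ 𝓕_B` (the absolute bound for `O(1)` depends only on `s, B, r` and `den(r)`)", `κ = k/n`.

## What is proved here (and the one deviation from print)
* `cT u v s B m θ k` is the closed form (4.2) of `R̂_n(k+θ)` over `ℝ` (`n = vm`, `rn = um`, `(2r+1)n = (2u+v)m`,
  `(n/den r)!^{den(r)(2r+1)|𝓕_B|} = m!^{(2u+v)|𝓕_B|}`), `R_cast_eq_cT` identifies it with the tree's `R u v s B m` at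
  `t = um + k + θ`; `cT_pos` (`θ > 0`).
* `log_cT_eq`: the logarithm as prefactor + `log(k+θ) + ∑_{θ'} ∑_{j<L} log(k+θ+θ'+j) − (s+1) ∑_{j≤n} log(um+k+θ+j)`.
* DEVIATION (the same shorter road as the tree's proof of [FSZ2019, Lemma 3], `FischlerSprangZudilin2019/Lemma3LogSums.lean`):
  instead of Stirling's formula for `Γ` we use the elementary sandwich of `∑ log(a+ℓ)` between differences of
  `F(t) = t log t − t` (tree: `Lemma3.sum_log_le`, `Lemma3.sum_log_ge`), i.e. Stirling to the precision `O(log)`. With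
  the scaling rule `F(ny) = nF(y) + ny log n` the main term is EXACTLY `n · Λ(k/n)` for the profile `Lam` (`Λ`;
  `mul_Lam_div`), where `Λ(x) = log A₁ + log A₂ − (s+1) + (2r+1)N(1 + log v) + N(F(x+2r+1) − F(x)) −
  (s+1)(F(x+r+1) − F(x+r))`, `N = |𝓕_B|`, `v = den r` (the sibling file `AnalysisLemmaProfile.lean` shows
  `Λ(x) = log g(x) + x log f(x) = log h(x)` — the printed `h`), and the error is uniform:
  **`log_cT_sub_Lam_le`** (`log R̂_n(k+θ) − nΛ(k/n) ≤ C(1 + log(n+1) + log(k+1))`, all `k ≥ 0`) and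
  **`abs_log_cT_sub_Lam_le`** (`|log R̂_n(k+θ) − nΛ(k/n)| ≤ C(1 + log(n+1) + log(k+1))`, all `k ≥ 1`), for all
  `m ≥ 1`, `θ ∈ (0,1]` — the printed "`n^{O(1)}` uniformly", here for EVERY `k` (so the printed first part, the
  monotonicity of `R̂_n` on `(0, 2c₁n]`, is not needed).

## Not here
The structure of `f`, `x₀`, the limits and the ratio: sibling files `AnalysisLemmaProfile.lean`, `AnalysisLemmaLimit.lean`,
`AnalysisLemmaRatio.lean`. Cell zeta5-irr (rung F-Z1): nothing here bears on `ζ(5)`.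
-/

noncomputable section

open Finset Filter

open scoped Nat

namespace Literature.NumberTheory.Irrationality.LaiYu2020

open Literature.NumberTheory.Irrationality.FischlerSprangZudilin2019.Lemma3 (F F_mul F_one F_sub_F_le le_F_sub_F
  F_sub_F_nonneg neg_one_le_F_sub_F sum_log_le sum_log_ge abs_log_factorial_sub_F_le)

namespace Lemma41

/-! ### The integer prefactors are positive -/

/-- `A₁(B)ⁿ > 0` (a product of positive powers of positive integers). [cite: LaiYu2020, §2 Def. 2.3] -/
theorem A₁pow_pos (u v : ℕ) (B : ℝ) (m : ℕ) : 0 < A₁pow u v B m :=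
  prod_pos fun _ hb => pow_pos ((denominatorSet_finite B).mem_toFinset.1 hb).1 _

/-- `A₂(B)ⁿ > 0`. [cite: LaiYu2020, §2 Def. 2.3] -/
theorem A₂pow_pos (u v : ℕ) (B : ℝ) (m : ℕ) : 0 < A₂pow u v B m :=
  prod_pos fun _ _ => prod_pos fun _ hp => pow_pos (Nat.prime_of_mem_primeFactors hp).pos _

/-! ### The shifted terms `R̂_n(k+θ)` -/

/-- **The prefactor `A₁(B)ⁿ A₂(B)ⁿ n!^{s+1} / (n/den r)!^{den(r)(2r+1)|𝓕_B|}`** of (4.2), for `r = u/v`, `n = vm`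
(so `(n/den r)!^{den(r)(2r+1)|𝓕_B|} = m!^{(2u+v)|𝓕_B|}`), over `ℝ`. [cite: LaiYu2020, §4 eq. (4.2)] -/
def pref (u v s : ℕ) (B : ℝ) (m : ℕ) : ℝ :=
  (A₁pow u v B m : ℝ) * (A₂pow u v B m : ℝ) * (((v * m)! : ℕ) : ℝ) ^ (s + 1) /
    ((m ! : ℕ) : ℝ) ^ ((2 * u + v) * (zeroSet_finite B).toFinset.card)

/-- **`R̂_n(k+θ) = R_n(rn + k + θ)`** in the closed form (4.2):
`pref · (k+θ) ∏_{θ' ∈ 𝓕_B} ∏_{j=0}^{(2r+1)n−1} (k+θ+j+θ') / ∏_{j=0}^{n} (rn+k+θ+j)^{s+1}` (over `ℝ`; `rn = um`,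
`(2r+1)n = (2u+v)m`, `n = vm`). [cite: LaiYu2020, §4 eq. (4.2)] -/
def cT (u v s : ℕ) (B : ℝ) (m : ℕ) (θ : ℚ) (k : ℕ) : ℝ :=
  pref u v s B m *
    (((k : ℝ) + θ) * ∏ θ' ∈ (zeroSet_finite B).toFinset,
        ∏ j ∈ range ((2 * u + v) * m), ((k : ℝ) + θ + j + θ')) /
      (∏ j ∈ range (v * m + 1), ((u : ℝ) * m + k + θ + j)) ^ (s + 1)

/-- `pref > 0`. [cite: LaiYu2020, §4 eq. (4.2)] -/
theorem pref_pos (u v s : ℕ) (B : ℝ) (m : ℕ) : 0 < pref u v s B m := by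
  have h1 : (0 : ℝ) < A₁pow u v B m := by exact_mod_cast A₁pow_pos u v B m
  have h2 : (0 : ℝ) < A₂pow u v B m := by exact_mod_cast A₂pow_pos u v B m
  unfold pref
  positivity

/-- Elements of `𝓕_B` are in `(0, 1]`. [cite: LaiYu2020, Def. 2.1 (2)] -/
theorem mem_toFinset_pos {B : ℝ} {θ : ℚ} (h : θ ∈ (zeroSet_finite B).toFinset) : 0 < θ ∧ θ ≤ 1 := by
  obtain ⟨h0, h1, -⟩ := (mem_zeroSet).1 ((zeroSet_finite B).mem_toFinset.1 h)
  exact ⟨h0, h1⟩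

/-- **`R̂_n(k+θ)` is the tree's `R_n` at `rn + k + θ`**. [cite: LaiYu2020, §4 ("R̂_n(t) = R_n(t+rn)") and eq. (4.2)] -/
theorem R_cast_eq_cT (u v s : ℕ) (B : ℝ) (m : ℕ) (θ : ℚ) (k : ℕ) :
    ((R u v s B m ((u : ℚ) * m + k + θ) : ℚ) : ℝ) = cT u v s B m θ k := by
  have hnum : (∏ θ' ∈ (zeroSet_finite B).toFinset, ∏ j ∈ range ((2 * u + v) * m),
      ((u : ℚ) * m + k + θ - u * m + j + θ')) =
      ∏ θ' ∈ (zeroSet_finite B).toFinset, ∏ j ∈ range ((2 * u + v) * m), ((k : ℚ) + θ + j + θ') :=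
    prod_congr rfl fun _ _ => prod_congr rfl fun _ _ => by ring
  have h1 : ((u : ℚ) * m + k + θ - u * m) = (k : ℚ) + θ := by ring
  rw [R, hnum, h1, cT, pref]
  push_cast
  ring

/-- **`R̂_n(k+θ) > 0`** for `θ > 0` ("a sum of positive terms"). [cite: LaiYu2020, §4 proof of Lemma 4.1 (eq. (4.2))] -/
theorem cT_pos (u v s : ℕ) (B : ℝ) (m : ℕ) {θ : ℚ} (hθ : 0 < θ) (k : ℕ) : 0 < cT u v s B m θ k := by
  have hθ' : (0 : ℝ) < θ := by exact_mod_cast hθ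
  have hp := pref_pos u v s B m
  unfold cT
  refine div_pos (mul_pos hp (mul_pos (by positivity) (prod_pos fun θ' hθ' => prod_pos fun j _ => ?_)))
    (pow_pos (prod_pos fun j _ => by positivity) _)
  have : (0 : ℝ) < θ' := by exact_mod_cast (mem_toFinset_pos hθ').1
  positivity

/-- **The logarithm of the prefactor**: `log pref = log A₁ⁿ + log A₂ⁿ + (s+1) log n! − (2u+v)|𝓕_B| log m!`.
[cite: LaiYu2020, §4 eq. (4.2)] -/
theorem log_pref (u v s : ℕ) (B : ℝ) (m : ℕ) :
    Real.log (pref u v s B m) = Real.log (A₁pow u v B m : ℝ) + Real.log (A₂pow u v B m : ℝ) +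
      ((s : ℝ) + 1) * Real.log (((v * m)! : ℕ) : ℝ) -
      ((2 * u + v) * (zeroSet_finite B).toFinset.card : ℕ) * Real.log ((m ! : ℕ) : ℝ) := by
  have h1 : (0 : ℝ) < A₁pow u v B m := by exact_mod_cast A₁pow_pos u v B m
  have h2 : (0 : ℝ) < A₂pow u v B m := by exact_mod_cast A₂pow_pos u v B m
  have h3 : (0 : ℝ) < (((v * m)! : ℕ) : ℝ) := by positivity
  have h4 : (0 : ℝ) < ((m ! : ℕ) : ℝ) := by positivity
  unfold pref
  rw [Real.log_div (by positivity) (by positivity), Real.log_mul (by positivity) (by positivity),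
    Real.log_mul h1.ne' h2.ne', Real.log_pow, Real.log_pow]
  push_cast
  ring

/-- **The logarithm of `R̂_n(k+θ)`** (`θ > 0`):
`log R̂_n(k+θ) = log pref + log(k+θ) + ∑_{θ'} ∑_{j<(2u+v)m} log((k+θ+θ')+j) − (s+1) ∑_{j ≤ vm} log((um+k+θ)+j)`.
[cite: LaiYu2020, §4 eqs. (4.2)–(4.3)] -/
theorem log_cT_eq (u v s : ℕ) (B : ℝ) (m : ℕ) {θ : ℚ} (hθ : 0 < θ) (k : ℕ) :
    Real.log (cT u v s B m θ k) = Real.log (pref u v s B m) + Real.log ((k : ℝ) + θ) +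
      ∑ θ' ∈ (zeroSet_finite B).toFinset, ∑ j ∈ range ((2 * u + v) * m), Real.log (((k : ℝ) + θ + θ') + j) -
      ((s : ℝ) + 1) * ∑ j ∈ range (v * m + 1), Real.log (((u : ℝ) * m + k + θ) + j) := by
  have hθ' : (0 : ℝ) < θ := by exact_mod_cast hθ
  have hp := pref_pos u v s B m
  have hfac : ∀ θ' ∈ (zeroSet_finite B).toFinset, ∀ j ∈ range ((2 * u + v) * m),
      (0 : ℝ) < (k : ℝ) + θ + j + θ' := by
    intro θ' hθ' j _
    have : (0 : ℝ) < θ' := by exact_mod_cast (mem_toFinset_pos hθ').1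
    positivity
  have hP : ∀ θ' ∈ (zeroSet_finite B).toFinset,
      0 < ∏ j ∈ range ((2 * u + v) * m), ((k : ℝ) + θ + j + θ') :=
    fun θ' hθ' => prod_pos fun j hj => hfac θ' hθ' j hj
  have hPP : 0 < ∏ θ' ∈ (zeroSet_finite B).toFinset, ∏ j ∈ range ((2 * u + v) * m), ((k : ℝ) + θ + j + θ') :=
    prod_pos hP
  have hQ : 0 < ∏ j ∈ range (v * m + 1), ((u : ℝ) * m + k + θ + j) := prod_pos fun j _ => by positivity
  unfold cT
  rw [Real.log_div (mul_pos hp (mul_pos (by positivity) hPP)).ne' (pow_pos hQ _).ne',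
    Real.log_mul hp.ne' (mul_pos (by positivity) hPP).ne', Real.log_mul (by positivity) hPP.ne',
    Real.log_pow, Real.log_prod (fun θ' hθ' => (hP θ' hθ').ne'), Real.log_prod (fun j _ => by positivity)]
  have hinner : ∀ θ' ∈ (zeroSet_finite B).toFinset,
      Real.log (∏ j ∈ range ((2 * u + v) * m), ((k : ℝ) + θ + j + θ')) =
        ∑ j ∈ range ((2 * u + v) * m), Real.log (((k : ℝ) + θ + θ') + j) := by
    intro θ' hθ'
    rw [Real.log_prod (fun j hj => (hfac θ' hθ' j hj).ne')]
    exact sum_congr rfl fun j _ => by ring_nf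
  rw [sum_congr rfl hinner]
  push_cast
  ring

/-! ### The profile `Λ` and the exact main term -/

/-- **The logarithmic profile** `Λ(x) = log A₁(B) + log A₂(B) − (s+1) + (2r+1)|𝓕_B|(1 + log den r) +
|𝓕_B|(F(x+2r+1) − F(x)) − (s+1)(F(x+r+1) − F(x+r))` (`r = u/v`, `den r` rendered as `v`; `F(t) = t log t − t`). The
sibling file shows `Λ(x) = log g(x) + x log f(x) = log h(x)` for the printed `f`, `g`, `h`, so that `Λ(x₀) = log g(x₀)`
at the root `f(x₀) = 1`. [cite: LaiYu2020, §4 proof of Lemma 4.1, eq. (4.7) (h(κ) = f(κ)^κ g(κ))] -/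
def Lam (u v s : ℕ) (B : ℝ) (x : ℝ) : ℝ :=
  Real.log (A₁ ((u : ℚ) / v) B) + Real.log (A₂ ((u : ℚ) / v) B) - ((s : ℝ) + 1) +
    (2 * (u : ℝ) + v) / v * ((zeroSet_finite B).toFinset.card : ℝ) * (1 + Real.log v) +
    ((zeroSet_finite B).toFinset.card : ℝ) * (F (x + (2 * (u : ℝ) + v) / v) - F x) -
    ((s : ℝ) + 1) * (F (x + (u : ℝ) / v + 1) - F (x + (u : ℝ) / v))

/-- **The main term is exact**: for `n = vm ≥ 1`,
`n Λ(k/n) = log A₁ⁿ + log A₂ⁿ + (s+1)F(n) − (2u+v)|𝓕_B| F(m) + |𝓕_B|(F(k+(2u+v)m) − F(k)) − (s+1)(F(um+k+n) − F(um+k))`.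
[cite: LaiYu2020, §4 proof of Lemma 4.1, eq. (4.7) ("a calculation shows")] -/
theorem mul_Lam_div {u v : ℕ} (hv : 1 ≤ v) (s : ℕ) (B : ℝ) {m : ℕ} (hm : 1 ≤ m) (k : ℕ) :
    ((v * m : ℕ) : ℝ) * Lam u v s B ((k : ℝ) / ((v * m : ℕ) : ℝ)) =
      Real.log (A₁pow u v B m : ℝ) + Real.log (A₂pow u v B m : ℝ) + ((s : ℝ) + 1) * F ((v * m : ℕ) : ℝ) -
      ((2 * u + v) * (zeroSet_finite B).toFinset.card : ℕ) * F m +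
      ((zeroSet_finite B).toFinset.card : ℝ) * (F ((k : ℝ) + (((2 * u + v) * m : ℕ) : ℝ)) - F k) -
      ((s : ℝ) + 1) * (F ((u : ℝ) * m + k + ((v * m : ℕ) : ℝ)) - F ((u : ℝ) * m + k)) := by
  have hv0 : (0 : ℝ) < v := by exact_mod_cast hv
  have hm0 : (0 : ℝ) < m := by exact_mod_cast hm
  set n : ℝ := ((v * m : ℕ) : ℝ) with hn
  have hn' : n = (v : ℝ) * m := by rw [hn]; push_cast; ring
  have hn0 : 0 < n := by rw [hn']; positivity
  have hn1 : n ≠ 0 := hn0.ne'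
  set N : ℝ := ((zeroSet_finite B).toFinset.card : ℝ) with hN
  -- the powers `A₁ⁿ`, `A₂ⁿ`
  have hA1 : Real.log (A₁pow u v B m : ℝ) = n * Real.log (A₁ ((u : ℚ) / v) B) := by
    rw [← A₁_pow hv B m, Real.log_pow, hn]
  have hA2 : Real.log (A₂pow u v B m : ℝ) = n * Real.log (A₂ ((u : ℚ) / v) B) := by
    rw [← A₂_pow hv B m, Real.log_pow, hn]
  -- scaling of `F`
  have hk0 : (0 : ℝ) ≤ k := Nat.cast_nonneg k
  have e1 : F ((k : ℝ) + (((2 * u + v) * m : ℕ) : ℝ)) = n * F ((k : ℝ) / n + (2 * (u : ℝ) + v) / v) +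
      n * ((k : ℝ) / n + (2 * (u : ℝ) + v) / v) * Real.log n := by
    rw [← F_mul hn0 (by positivity)]
    congr 1
    rw [hn']
    push_cast
    field_simp
  have e2 : F (k : ℝ) = n * F ((k : ℝ) / n) + n * ((k : ℝ) / n) * Real.log n := by
    rw [← F_mul hn0 (by positivity)]
    congr 1
    field_simp
  have e3 : F ((u : ℝ) * m + k + n) = n * F ((k : ℝ) / n + (u : ℝ) / v + 1) +
      n * ((k : ℝ) / n + (u : ℝ) / v + 1) * Real.log n := by
    rw [← F_mul hn0 (by positivity)]
    congr 1
    rw [hn']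
    field_simp
    ring
  have e4 : F ((u : ℝ) * m + k) = n * F ((k : ℝ) / n + (u : ℝ) / v) +
      n * ((k : ℝ) / n + (u : ℝ) / v) * Real.log n := by
    rw [← F_mul hn0 (by positivity)]
    congr 1
    rw [hn']
    field_simp
    ring
  have e5 : F n = n * F 1 + n * 1 * Real.log n := by
    rw [← F_mul hn0 zero_le_one, mul_one]
  -- `F(m)` through `F(n) = F(v m)`: `F(m) = m log m − m`, `log n = log v + log m`
  have e6 : F (m : ℝ) = (m : ℝ) * Real.log m - m := rfl
  have hlogn : Real.log n = Real.log v + Real.log m := by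
    rw [hn', Real.log_mul hv0.ne' hm0.ne']
  have hcast : (((2 * u + v) * (zeroSet_finite B).toFinset.card : ℕ) : ℝ) = (2 * (u : ℝ) + v) * N := by
    rw [hN]; push_cast; ring
  rw [hA1, hA2, hcast, e1, e2, e3, e4, e5, e6, F_one, Lam, ← hN, hlogn]
  rw [hn']
  field_simp
  ring

/-! ### The uniform estimate -/

/-- `log(k + (2u+v)m + 2) ≤ log(2u+v+2) + log(n+1) + log(k+1)` (`n = vm`, `v ≥ 1`).
[cite: LaiYu2020, §4 proof of Lemma 4.1 (the factor n^{O(1)} in eq. (4.7))] -/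
theorem log_lin_le_num {u v : ℕ} (hv : 1 ≤ v) (m k : ℕ) :
    Real.log ((k : ℝ) + (((2 * u + v) * m : ℕ) : ℝ) + 2) ≤
      Real.log (2 * (u : ℝ) + v + 2) + Real.log (((v * m : ℕ) : ℝ) + 1) + Real.log ((k : ℝ) + 1) := by
  have hv' : (1 : ℝ) ≤ v := by exact_mod_cast hv
  have hm : (0 : ℝ) ≤ m := Nat.cast_nonneg m
  have hk : (0 : ℝ) ≤ k := Nat.cast_nonneg k
  have hu : (0 : ℝ) ≤ u := Nat.cast_nonneg u
  rw [← Real.log_mul (by positivity) (by positivity), ← Real.log_mul (by positivity) (by positivity)]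
  refine Real.log_le_log (by positivity) ?_
  push_cast
  have h1 : (m : ℝ) ≤ v * m := by nlinarith
  nlinarith [mul_nonneg hk hm, mul_nonneg (mul_nonneg hu hk) hm, mul_nonneg hu hm, mul_nonneg hk (by positivity : (0:ℝ) ≤ v * m),
    mul_nonneg hu (by linarith : (0:ℝ) ≤ v * m - m)]

/-- `log(um + k + n + 2) ≤ log(u+v+2) + log(n+1) + log(k+1)` (`n = vm`, `v ≥ 1`).
[cite: LaiYu2020, §4 proof of Lemma 4.1 (the factor n^{O(1)} in eq. (4.7))] -/
theorem log_lin_le_den {u v : ℕ} (hv : 1 ≤ v) (m k : ℕ) :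
    Real.log ((u : ℝ) * m + k + ((v * m : ℕ) : ℝ) + 2) ≤
      Real.log ((u : ℝ) + v + 2) + Real.log (((v * m : ℕ) : ℝ) + 1) + Real.log ((k : ℝ) + 1) := by
  have hv' : (1 : ℝ) ≤ v := by exact_mod_cast hv
  have hm : (0 : ℝ) ≤ m := Nat.cast_nonneg m
  have hk : (0 : ℝ) ≤ k := Nat.cast_nonneg k
  have hu : (0 : ℝ) ≤ u := Nat.cast_nonneg u
  rw [← Real.log_mul (by positivity) (by positivity), ← Real.log_mul (by positivity) (by positivity)]
  refine Real.log_le_log (by positivity) ?_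
  push_cast
  have h1 : (m : ℝ) ≤ v * m := by nlinarith
  nlinarith [mul_nonneg hk hm, mul_nonneg (mul_nonneg hu hk) hm, mul_nonneg hu hm, mul_nonneg hk (by positivity : (0:ℝ) ≤ v * m),
    mul_nonneg hu (by linarith : (0:ℝ) ≤ v * m - m)]

/-- **One numerator block against its main term, from above**: for `a ∈ (k, k+2]` (`a = k + θ + θ'`) and `L ≥ 0`,
`∑_{j<L} log(a+j) − (F(k+L) − F(k)) ≤ 2 log(k+L+2) + 1`. [cite: LaiYu2020, §4 proof of Lemma 4.1 (Stirling step for ∏(t+j+θ'))] -/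
theorem num_block_upper {a : ℝ} {k L : ℕ} (hak : (k : ℝ) < a) (hak2 : a ≤ (k : ℝ) + 2) :
    ∑ j ∈ range L, Real.log (a + j) - (F ((k : ℝ) + L) - F k) ≤ 2 * Real.log ((k : ℝ) + L + 2) + 1 := by
  have hk : (0 : ℝ) ≤ k := Nat.cast_nonneg k
  have ha : 0 < a := lt_of_le_of_lt hk hak
  have hU := sum_log_le ha L
  have h1 : F (a + L) - F ((k : ℝ) + L) ≤ 2 * Real.log ((k : ℝ) + L + 2) := by
    have h := F_sub_F_le (u := (k : ℝ) + L) (v := a + L) (by positivity) (by linarith)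
    have hlog : Real.log (a + L) ≤ Real.log ((k : ℝ) + L + 2) := Real.log_le_log (by positivity) (by linarith)
    have hlog0 : 0 ≤ Real.log ((k : ℝ) + L + 2) := Real.log_nonneg (by linarith)
    rcases le_or_gt 0 (Real.log (a + L)) with hpos | hneg
    · nlinarith
    · nlinarith
  have h2 : -1 ≤ F a - F k := neg_one_le_F_sub_F hk hak.le
  linarith

/-- **One numerator block against its main term, from below** (`k ≥ 1`, so `a ≥ 1`):
`−(3 log(k+L+2) + 1) ≤ ∑_{j<L} log(a+j) − (F(k+L) − F(k))`. [cite: LaiYu2020, §4 proof of Lemma 4.1 (Stirling step for ∏(t+j+θ'))] -/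
theorem num_block_lower {a : ℝ} {k L : ℕ} (hk1 : 1 ≤ k) (hak : (k : ℝ) < a) (hak2 : a ≤ (k : ℝ) + 2) :
    -(3 * Real.log ((k : ℝ) + L + 2) + 1) ≤ ∑ j ∈ range L, Real.log (a + j) - (F ((k : ℝ) + L) - F k) := by
  have hk : (1 : ℝ) ≤ k := by exact_mod_cast hk1
  have ha : 1 ≤ a := by linarith
  have hL := sum_log_ge ha L
  have hlog0 : 0 ≤ Real.log ((k : ℝ) + L + 2) := Real.log_nonneg (by linarith)
  have h1 : 0 ≤ F (a + L) - F ((k : ℝ) + L) := F_sub_F_nonneg (by linarith) (by linarith)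
  have h2 : F a - F k ≤ 2 * Real.log ((k : ℝ) + L + 2) := by
    have h := F_sub_F_le (u := (k : ℝ)) (v := a) (by linarith) hak.le
    have hlog : Real.log a ≤ Real.log ((k : ℝ) + L + 2) := Real.log_le_log (by linarith) (by
      have : (0 : ℝ) ≤ L := Nat.cast_nonneg L; linarith)
    have hloga : 0 ≤ Real.log a := Real.log_nonneg ha
    nlinarith
  have h3 : Real.log (a + L) ≤ Real.log ((k : ℝ) + L + 2) := Real.log_le_log (by linarith) (by linarith)
  linarith

/-- **The denominator block against its main term, two-sided**: for `b ∈ (w, w+1]` (`b = um+k+θ`, `w = um+k ≥ 1`),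
`|∑_{j ≤ n} log(b+j) − (F(w+n) − F(w))| ≤ 2 log(w+n+2) + 1`. [cite: LaiYu2020, §4 proof of Lemma 4.1 (Stirling step for ∏(t+rn+j))] -/
theorem den_block_abs {b w : ℝ} {n : ℕ} (hw : 1 ≤ w) (hbw : w < b) (hbw1 : b ≤ w + 1) :
    |∑ j ∈ range (n + 1), Real.log (b + j) - (F (w + n) - F w)| ≤ 2 * Real.log (w + n + 2) + 1 := by
  have hb : 1 ≤ b := by linarith
  have hU := sum_log_le (by linarith : 0 < b) (n + 1)
  have hL := sum_log_ge hb (n + 1)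
  push_cast at hU hL
  have hlog0 : 0 ≤ Real.log (w + n + 2) := Real.log_nonneg (by have : (0:ℝ) ≤ n := Nat.cast_nonneg n; linarith)
  have hn0 : (0 : ℝ) ≤ n := Nat.cast_nonneg n
  have h1 : F (b + (n + 1)) - F (w + n) ≤ 2 * Real.log (w + n + 2) := by
    have h := F_sub_F_le (u := w + n) (v := b + (n + 1)) (by linarith) (by linarith)
    have hlog : Real.log (b + (n + 1)) ≤ Real.log (w + n + 2) := Real.log_le_log (by linarith) (by linarith)
    have hlogb : 0 ≤ Real.log (b + (n + 1)) := Real.log_nonneg (by linarith)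
    nlinarith
  have h1' : 0 ≤ F (b + (n + 1)) - F (w + n) := F_sub_F_nonneg (by linarith) (by linarith)
  have h2 : F b - F w ≤ Real.log (w + n + 2) := by
    have h := F_sub_F_le (u := w) (v := b) (by linarith) hbw.le
    have hlog : Real.log b ≤ Real.log (w + n + 2) := Real.log_le_log (by linarith) (by linarith)
    have hlogb : 0 ≤ Real.log b := Real.log_nonneg hb
    nlinarith
  have h2' : 0 ≤ F b - F w := F_sub_F_nonneg hw hbw.le
  have h3 : Real.log (b + (n + 1)) ≤ Real.log (w + n + 2) := Real.log_le_log (by linarith) (by linarith)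
  have h3' : 0 ≤ Real.log (b + (n + 1)) := Real.log_nonneg (by linarith)
  rw [abs_le]
  constructor <;> linarith

/-- **The constant of the uniform estimate** (depends on `u, v, s, |𝓕_B|` only).
[cite: LaiYu2020, §4 proof of Lemma 4.1 ("the absolute bound for O(1) depends only on s, B, r and den(r)")] -/
def Cunif (u v s N : ℕ) : ℝ :=
  ((s : ℝ) + 1) * (2 * Real.log ((u : ℝ) + v + 2) + 4) + ((2 * (u : ℝ) + v) * N) * 2 + 2 +
    (N : ℝ) * (3 * Real.log (2 * (u : ℝ) + v + 2) + 4)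

/-- `Cunif > 0`. [cite: LaiYu2020, §4 proof of Lemma 4.1 (the O(1))] -/
theorem Cunif_pos (u v s N : ℕ) : 0 < Cunif u v s N := by
  have h1 : 0 ≤ Real.log ((u : ℝ) + v + 2) := Real.log_nonneg (by
    have : (0:ℝ) ≤ u := Nat.cast_nonneg u; have : (0:ℝ) ≤ v := Nat.cast_nonneg v; linarith)
  have h2 : 0 ≤ Real.log (2 * (u : ℝ) + v + 2) := Real.log_nonneg (by
    have : (0:ℝ) ≤ u := Nat.cast_nonneg u; have : (0:ℝ) ≤ v := Nat.cast_nonneg v; linarith)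
  unfold Cunif
  positivity

/-- **Uniform Stirling estimate, upper half** (all `k ≥ 0`): for `m ≥ 1`, `um ≥ 1`, `v ≥ 1`, `0 < θ ≤ 1`,
`log R̂_n(k+θ) − nΛ(k/n) ≤ C(1 + log(n+1) + log(k+1))` with `C = Cunif u v s |𝓕_B|`.
[cite: LaiYu2020, §4 proof of Lemma 4.1, eqs. (4.7)–(4.8) ("R̂_n(k+θ) ≤ n^{O(1)} g(x₀)ⁿ")] -/
theorem log_cT_sub_Lam_le {u v s : ℕ} {B : ℝ} {m : ℕ} (hv : 1 ≤ v) (hm : 1 ≤ m) (hum : 1 ≤ u * m)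
    {θ : ℚ} (hθ0 : 0 < θ) (hθ1 : θ ≤ 1) (k : ℕ) :
    Real.log (cT u v s B m θ k) - ((v * m : ℕ) : ℝ) * Lam u v s B ((k : ℝ) / ((v * m : ℕ) : ℝ)) ≤
      Cunif u v s (zeroSet_finite B).toFinset.card *
        (1 + Real.log (((v * m : ℕ) : ℝ) + 1) + Real.log ((k : ℝ) + 1)) := by
  rw [log_cT_eq u v s B m hθ0 k, log_pref, mul_Lam_div hv s B hm k]
  set N : ℕ := (zeroSet_finite B).toFinset.card with hN
  set n : ℕ := v * m with hn
  set L : ℕ := (2 * u + v) * m with hL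
  have hθ0' : (0 : ℝ) < θ := by exact_mod_cast hθ0
  have hθ1' : (θ : ℝ) ≤ 1 := by exact_mod_cast hθ1
  have hk0 : (0 : ℝ) ≤ k := Nat.cast_nonneg k
  have hum' : (1 : ℝ) ≤ (u : ℝ) * m := by exact_mod_cast hum
  have hn1 : 1 ≤ n := by rw [hn]; nlinarith
  have hmn : m ≤ n := by rw [hn]; nlinarith
  have hn1' : (1 : ℝ) ≤ n := by exact_mod_cast hn1
  -- (1) factorials
  have h1 := abs_log_factorial_sub_F_le hn1
  have h1m := abs_log_factorial_sub_F_le hm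
  rw [abs_le] at h1 h1m
  have hlogm : Real.log ((m : ℝ) + 1) ≤ Real.log ((n : ℝ) + 1) :=
    Real.log_le_log (by positivity) (by exact_mod_cast Nat.add_le_add_right hmn 1)
  -- (2) log(k+θ) ≤ log(k+1)
  have h2 : Real.log ((k : ℝ) + θ) ≤ Real.log ((k : ℝ) + 1) := Real.log_le_log (by positivity) (by linarith)
  -- (3) numerator blocks
  set Lk := Real.log ((k : ℝ) + (L : ℝ) + 2) with hLk
  have hLk0 : 0 ≤ Lk := Real.log_nonneg (by have : (0:ℝ) ≤ L := Nat.cast_nonneg L; linarith)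
  have h3 : ∀ θ' ∈ (zeroSet_finite B).toFinset,
      ∑ j ∈ range L, Real.log (((k : ℝ) + θ + θ') + j) - (F ((k : ℝ) + L) - F k) ≤ 2 * Lk + 1 := by
    intro θ' hθ'
    obtain ⟨hp, hle⟩ := mem_toFinset_pos hθ'
    have hp' : (0 : ℝ) < θ' := by exact_mod_cast hp
    have hle' : (θ' : ℝ) ≤ 1 := by exact_mod_cast hle
    exact num_block_upper (by linarith) (by linarith)
  have h3sum : ∑ θ' ∈ (zeroSet_finite B).toFinset, ∑ j ∈ range L, Real.log (((k : ℝ) + θ + θ') + j) -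
      (N : ℝ) * (F ((k : ℝ) + L) - F k) ≤ (N : ℝ) * (2 * Lk + 1) := by
    have := sum_le_sum h3
    rw [sum_sub_distrib, sum_const, sum_const, ← hN, nsmul_eq_mul, nsmul_eq_mul] at this
    linarith
  -- (4) denominator block
  set Wk := Real.log ((u : ℝ) * m + k + (n : ℝ) + 2) with hWk
  have hWk0 : 0 ≤ Wk := Real.log_nonneg (by linarith)
  have h4 : |∑ j ∈ range (n + 1), Real.log (((u : ℝ) * m + k + θ) + j) -
      (F ((u : ℝ) * m + k + n) - F ((u : ℝ) * m + k))| ≤ 2 * Wk + 1 :=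
    den_block_abs (b := (u : ℝ) * m + k + θ) (w := (u : ℝ) * m + k) (n := n) (by linarith)
      (by linarith) (by linarith)
  rw [abs_le] at h4
  -- logs against log(n+1) + log(k+1)
  have hl3 : Lk ≤ Real.log (2 * (u : ℝ) + v + 2) + Real.log ((n : ℝ) + 1) + Real.log ((k : ℝ) + 1) := by
    rw [hLk, hL, hn]; exact log_lin_le_num hv m k
  have hl4 : Wk ≤ Real.log ((u : ℝ) + v + 2) + Real.log ((n : ℝ) + 1) + Real.log ((k : ℝ) + 1) := by
    rw [hWk, hn]; exact log_lin_le_den hv m k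
  set ln := Real.log ((n : ℝ) + 1) with hln
  set lk := Real.log ((k : ℝ) + 1) with hlk
  have hln0 : 0 ≤ ln := Real.log_nonneg (by linarith)
  have hlk0 : 0 ≤ lk := Real.log_nonneg (by linarith)
  have hs0 : (0 : ℝ) ≤ (s : ℝ) + 1 := by positivity
  have hN0 : (0 : ℝ) ≤ N := Nat.cast_nonneg N
  have hE0 : (0 : ℝ) ≤ (2 * (u : ℝ) + v) * N := by positivity
  have hcastE : (((2 * u + v) * N : ℕ) : ℝ) = (2 * (u : ℝ) + v) * N := by push_cast; ring
  rw [hcastE]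
  -- products for linarith
  have p1 := mul_le_mul_of_nonneg_left h1.2 hs0
  have p1m := mul_le_mul_of_nonneg_left h1m.1 hE0
  have p1m' := mul_le_mul_of_nonneg_left hlogm hE0
  have p4 := mul_le_mul_of_nonneg_left h4.1 hs0
  have q3 := mul_le_mul_of_nonneg_left hl3 hN0
  have q4 := mul_le_mul_of_nonneg_left hl4 hs0
  have hlu : 0 ≤ Real.log ((u : ℝ) + v + 2) := Real.log_nonneg (by
    have : (0:ℝ) ≤ u := Nat.cast_nonneg u; linarith)
  have hlu2 : 0 ≤ Real.log (2 * (u : ℝ) + v + 2) := Real.log_nonneg (by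
    have : (0:ℝ) ≤ u := Nat.cast_nonneg u; linarith)
  have nn1 : 0 ≤ ((s : ℝ) + 1) * (ln + lk) := mul_nonneg hs0 (add_nonneg hln0 hlk0)
  have nn2 : 0 ≤ (2 * (u : ℝ) + v) * N * (ln + lk) := mul_nonneg hE0 (add_nonneg hln0 hlk0)
  have nn3 : 0 ≤ (N : ℝ) * (ln + lk) := mul_nonneg hN0 (add_nonneg hln0 hlk0)
  have nn4 : 0 ≤ ((s : ℝ) + 1) * Real.log ((u : ℝ) + v + 2) * (ln + lk) :=
    mul_nonneg (mul_nonneg hs0 hlu) (add_nonneg hln0 hlk0)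
  have nn5 : 0 ≤ (N : ℝ) * Real.log (2 * (u : ℝ) + v + 2) * (ln + lk) :=
    mul_nonneg (mul_nonneg hN0 hlu2) (add_nonneg hln0 hlk0)
  have nn6 : 0 ≤ (2 * (u : ℝ) + v) * N * lk := mul_nonneg hE0 hlk0
  have T1 : ((s : ℝ) + 1) * Real.log (n ! : ℝ) - ((s : ℝ) + 1) * F n ≤ ((s : ℝ) + 1) * (ln + 1) := by
    linarith [p1]
  have T2 : -((2 * (u : ℝ) + v) * N * Real.log (m ! : ℝ)) + (2 * (u : ℝ) + v) * N * F m ≤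
      (2 * (u : ℝ) + v) * N * (ln + 1) := by linarith [p1m, p1m']
  have T3 : ∑ θ' ∈ (zeroSet_finite B).toFinset, ∑ j ∈ range L, Real.log (((k : ℝ) + θ + θ') + j) -
      (N : ℝ) * (F ((k : ℝ) + L) - F k) ≤ (N : ℝ) * (2 * (Real.log (2 * (u : ℝ) + v + 2) + ln + lk) + 1) := by
    linarith [h3sum, q3]
  have T4 : -(((s : ℝ) + 1) * ∑ j ∈ range (n + 1), Real.log (((u : ℝ) * m + k + θ) + j)) +
      ((s : ℝ) + 1) * (F ((u : ℝ) * m + k + n) - F ((u : ℝ) * m + k)) ≤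
      ((s : ℝ) + 1) * (2 * (Real.log ((u : ℝ) + v + 2) + ln + lk) + 1) := by linarith [p4, q4]
  have m1 : 0 ≤ ((s : ℝ) + 1) * ln := mul_nonneg hs0 hln0
  have m2 : 0 ≤ ((s : ℝ) + 1) * lk := mul_nonneg hs0 hlk0
  have m3 : 0 ≤ (2 * (u : ℝ) + v) * N * ln := mul_nonneg hE0 hln0
  have m5 : 0 ≤ (N : ℝ) * ln := mul_nonneg hN0 hln0
  have m6 : 0 ≤ (N : ℝ) * lk := mul_nonneg hN0 hlk0
  have m7 : 0 ≤ (N : ℝ) * Real.log (2 * (u : ℝ) + v + 2) := mul_nonneg hN0 hlu2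
  have m8 : 0 ≤ ((s : ℝ) + 1) * Real.log ((u : ℝ) + v + 2) := mul_nonneg hs0 hlu
  have m9 : 0 ≤ ((s : ℝ) + 1) * Real.log ((u : ℝ) + v + 2) * ln := mul_nonneg m8 hln0
  have m10 : 0 ≤ ((s : ℝ) + 1) * Real.log ((u : ℝ) + v + 2) * lk := mul_nonneg m8 hlk0
  have m11 : 0 ≤ (N : ℝ) * Real.log (2 * (u : ℝ) + v + 2) * ln := mul_nonneg m7 hln0
  have m12 : 0 ≤ (N : ℝ) * Real.log (2 * (u : ℝ) + v + 2) * lk := mul_nonneg m7 hlk0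
  unfold Cunif
  linarith [T1, T2, T3, T4, h2, nn6, m1, m2, m3, m5, m6, m7, m8, m9, m10, m11, m12, hlk0, hln0, hlu, hlu2,
    hs0, hN0, hE0]

/-- **Uniform Stirling estimate, two-sided** (`k ≥ 1`): for `m ≥ 1`, `um ≥ 1`, `v ≥ 1`, `0 < θ ≤ 1`,
`|log R̂_n(k+θ) − nΛ(k/n)| ≤ C(1 + log(n+1) + log(k+1))` with `C = Cunif u v s |𝓕_B|` — the printed
"`R̂_n(k+θ) = n^{O(1)} h(κ)ⁿ` uniformly". [cite: LaiYu2020, §4 proof of Lemma 4.1, eq. (4.7)] -/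
theorem abs_log_cT_sub_Lam_le {u v s : ℕ} {B : ℝ} {m : ℕ} (hv : 1 ≤ v) (hm : 1 ≤ m) (hum : 1 ≤ u * m)
    {θ : ℚ} (hθ0 : 0 < θ) (hθ1 : θ ≤ 1) {k : ℕ} (hk : 1 ≤ k) :
    |Real.log (cT u v s B m θ k) - ((v * m : ℕ) : ℝ) * Lam u v s B ((k : ℝ) / ((v * m : ℕ) : ℝ))| ≤
      Cunif u v s (zeroSet_finite B).toFinset.card *
        (1 + Real.log (((v * m : ℕ) : ℝ) + 1) + Real.log ((k : ℝ) + 1)) := by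
  rw [abs_le]
  refine ⟨?_, log_cT_sub_Lam_le hv hm hum hθ0 hθ1 k⟩
  rw [log_cT_eq u v s B m hθ0 k, log_pref, mul_Lam_div hv s B hm k]
  set N : ℕ := (zeroSet_finite B).toFinset.card with hN
  set n : ℕ := v * m with hn
  set L : ℕ := (2 * u + v) * m with hL
  have hθ0' : (0 : ℝ) < θ := by exact_mod_cast hθ0
  have hθ1' : (θ : ℝ) ≤ 1 := by exact_mod_cast hθ1
  have hk1 : (1 : ℝ) ≤ k := by exact_mod_cast hk
  have hum' : (1 : ℝ) ≤ (u : ℝ) * m := by exact_mod_cast hum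
  have hn1 : 1 ≤ n := by rw [hn]; nlinarith
  have hmn : m ≤ n := by rw [hn]; nlinarith
  have hn1' : (1 : ℝ) ≤ n := by exact_mod_cast hn1
  -- (1) factorials
  have h1 := abs_log_factorial_sub_F_le hn1
  have h1m := abs_log_factorial_sub_F_le hm
  rw [abs_le] at h1 h1m
  have hlogm : Real.log ((m : ℝ) + 1) ≤ Real.log ((n : ℝ) + 1) :=
    Real.log_le_log (by positivity) (by exact_mod_cast Nat.add_le_add_right hmn 1)
  -- (2) log(k+θ) ≥ 0
  have h2 : 0 ≤ Real.log ((k : ℝ) + θ) := Real.log_nonneg (by linarith)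
  -- (3) numerator blocks, lower
  set Lk := Real.log ((k : ℝ) + (L : ℝ) + 2) with hLk
  have hLk0 : 0 ≤ Lk := Real.log_nonneg (by have : (0:ℝ) ≤ L := Nat.cast_nonneg L; linarith)
  have h3 : ∀ θ' ∈ (zeroSet_finite B).toFinset,
      -(3 * Lk + 1) ≤ ∑ j ∈ range L, Real.log (((k : ℝ) + θ + θ') + j) - (F ((k : ℝ) + L) - F k) := by
    intro θ' hθ'
    obtain ⟨hp, hle⟩ := mem_toFinset_pos hθ'
    have hp' : (0 : ℝ) < θ' := by exact_mod_cast hp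
    have hle' : (θ' : ℝ) ≤ 1 := by exact_mod_cast hle
    exact num_block_lower hk (by linarith) (by linarith)
  have h3sum : -((N : ℝ) * (3 * Lk + 1)) ≤ ∑ θ' ∈ (zeroSet_finite B).toFinset,
      ∑ j ∈ range L, Real.log (((k : ℝ) + θ + θ') + j) - (N : ℝ) * (F ((k : ℝ) + L) - F k) := by
    have := sum_le_sum h3
    rw [sum_sub_distrib, sum_const, sum_const, ← hN, nsmul_eq_mul, nsmul_eq_mul] at this
    linarith
  -- (4) denominator block
  set Wk := Real.log ((u : ℝ) * m + k + (n : ℝ) + 2) with hWk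
  have hWk0 : 0 ≤ Wk := Real.log_nonneg (by have : (0:ℝ) ≤ k := Nat.cast_nonneg k; linarith)
  have h4 : |∑ j ∈ range (n + 1), Real.log (((u : ℝ) * m + k + θ) + j) -
      (F ((u : ℝ) * m + k + n) - F ((u : ℝ) * m + k))| ≤ 2 * Wk + 1 :=
    den_block_abs (b := (u : ℝ) * m + k + θ) (w := (u : ℝ) * m + k) (n := n) (by linarith)
      (by linarith) (by linarith)
  rw [abs_le] at h4
  have hl3 : Lk ≤ Real.log (2 * (u : ℝ) + v + 2) + Real.log ((n : ℝ) + 1) + Real.log ((k : ℝ) + 1) := by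
    rw [hLk, hL, hn]; exact log_lin_le_num hv m k
  have hl4 : Wk ≤ Real.log ((u : ℝ) + v + 2) + Real.log ((n : ℝ) + 1) + Real.log ((k : ℝ) + 1) := by
    rw [hWk, hn]; exact log_lin_le_den hv m k
  set ln := Real.log ((n : ℝ) + 1) with hln
  set lk := Real.log ((k : ℝ) + 1) with hlk
  have hln0 : 0 ≤ ln := Real.log_nonneg (by linarith)
  have hlk0 : 0 ≤ lk := Real.log_nonneg (by have : (0:ℝ) ≤ k := Nat.cast_nonneg k; linarith)
  have hs0 : (0 : ℝ) ≤ (s : ℝ) + 1 := by positivity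
  have hN0 : (0 : ℝ) ≤ N := Nat.cast_nonneg N
  have hE0 : (0 : ℝ) ≤ (2 * (u : ℝ) + v) * N := by positivity
  have hcastE : (((2 * u + v) * N : ℕ) : ℝ) = (2 * (u : ℝ) + v) * N := by push_cast; ring
  rw [hcastE]
  have p1 := mul_le_mul_of_nonneg_left h1.1 hs0
  have p1m := mul_le_mul_of_nonneg_left h1m.2 hE0
  have p1m' := mul_le_mul_of_nonneg_left hlogm hE0
  have p4 := mul_le_mul_of_nonneg_left h4.2 hs0
  have q3 := mul_le_mul_of_nonneg_left hl3 hN0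
  have q4 := mul_le_mul_of_nonneg_left hl4 hs0
  have hlu : 0 ≤ Real.log ((u : ℝ) + v + 2) := Real.log_nonneg (by
    have : (0:ℝ) ≤ u := Nat.cast_nonneg u; linarith)
  have hlu2 : 0 ≤ Real.log (2 * (u : ℝ) + v + 2) := Real.log_nonneg (by
    have : (0:ℝ) ≤ u := Nat.cast_nonneg u; linarith)
  have nn1 : 0 ≤ ((s : ℝ) + 1) * (ln + lk) := mul_nonneg hs0 (add_nonneg hln0 hlk0)
  have nn2 : 0 ≤ (2 * (u : ℝ) + v) * N * (ln + lk) := mul_nonneg hE0 (add_nonneg hln0 hlk0)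
  have nn3 : 0 ≤ (N : ℝ) * (ln + lk) := mul_nonneg hN0 (add_nonneg hln0 hlk0)
  have nn4 : 0 ≤ ((s : ℝ) + 1) * Real.log ((u : ℝ) + v + 2) * (ln + lk) :=
    mul_nonneg (mul_nonneg hs0 hlu) (add_nonneg hln0 hlk0)
  have nn5 : 0 ≤ (N : ℝ) * Real.log (2 * (u : ℝ) + v + 2) * (ln + lk) :=
    mul_nonneg (mul_nonneg hN0 hlu2) (add_nonneg hln0 hlk0)
  have nn6 : 0 ≤ (2 * (u : ℝ) + v) * N * lk := mul_nonneg hE0 hlk0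
  have h2' : Real.log ((k : ℝ) + θ) ≤ lk := Real.log_le_log (by linarith) (by linarith)
  have T1 : -(((s : ℝ) + 1) * Real.log (n ! : ℝ)) + ((s : ℝ) + 1) * F n ≤ ((s : ℝ) + 1) * (ln + 1) := by
    linarith [p1]
  have T2 : ((2 * (u : ℝ) + v) * N * Real.log (m ! : ℝ)) - (2 * (u : ℝ) + v) * N * F m ≤
      (2 * (u : ℝ) + v) * N * (ln + 1) := by linarith [p1m, p1m']
  have T3 : -(∑ θ' ∈ (zeroSet_finite B).toFinset, ∑ j ∈ range L, Real.log (((k : ℝ) + θ + θ') + j)) +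
      (N : ℝ) * (F ((k : ℝ) + L) - F k) ≤ (N : ℝ) * (3 * (Real.log (2 * (u : ℝ) + v + 2) + ln + lk) + 1) := by
    linarith [h3sum, q3]
  have T4 : (((s : ℝ) + 1) * ∑ j ∈ range (n + 1), Real.log (((u : ℝ) * m + k + θ) + j)) -
      ((s : ℝ) + 1) * (F ((u : ℝ) * m + k + n) - F ((u : ℝ) * m + k)) ≤
      ((s : ℝ) + 1) * (2 * (Real.log ((u : ℝ) + v + 2) + ln + lk) + 1) := by linarith [p4, q4]
  have m1 : 0 ≤ ((s : ℝ) + 1) * ln := mul_nonneg hs0 hln0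
  have m2 : 0 ≤ ((s : ℝ) + 1) * lk := mul_nonneg hs0 hlk0
  have m3 : 0 ≤ (2 * (u : ℝ) + v) * N * ln := mul_nonneg hE0 hln0
  have m5 : 0 ≤ (N : ℝ) * ln := mul_nonneg hN0 hln0
  have m6 : 0 ≤ (N : ℝ) * lk := mul_nonneg hN0 hlk0
  have m7 : 0 ≤ (N : ℝ) * Real.log (2 * (u : ℝ) + v + 2) := mul_nonneg hN0 hlu2
  have m8 : 0 ≤ ((s : ℝ) + 1) * Real.log ((u : ℝ) + v + 2) := mul_nonneg hs0 hlu
  have m9 : 0 ≤ ((s : ℝ) + 1) * Real.log ((u : ℝ) + v + 2) * ln := mul_nonneg m8 hln0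
  have m10 : 0 ≤ ((s : ℝ) + 1) * Real.log ((u : ℝ) + v + 2) * lk := mul_nonneg m8 hlk0
  have m11 : 0 ≤ (N : ℝ) * Real.log (2 * (u : ℝ) + v + 2) * ln := mul_nonneg m7 hln0
  have m12 : 0 ≤ (N : ℝ) * Real.log (2 * (u : ℝ) + v + 2) * lk := mul_nonneg m7 hlk0
  unfold Cunif
  linarith [T1, T2, T3, T4, h2, nn6, m1, m2, m3, m5, m6, m7, m8, m9, m10, m11, m12, hlk0, hln0, hlu, hlu2,
    hs0, hN0, hE0]

end Lemma41

end Literature.NumberTheory.Irrationality.LaiYu2020
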